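import Literature.Analysis.FluidPDE.PassiveVectorTensorLionsWeak
import Literature.Analysis.FluidPDE.PassiveVectorVarTensorGarding
import HarnessLib

/-!
# Damped `L²` weak solutions of the VARIABLE-tensor passive-vector equation by Lions' projection theorem

Analysis/FluidPDE file (everything proved; no definitions, no named facts). Variable-tensor twin of
`PassiveVectorTensorLionsWeak`: **J.-L. Lions' existence theorem** (`OperatorTheory.LionsProjection`;
Lions–Magenes 1972, Chap. 3, Thm. 1.1 and §4.3–§4.4: parabolic problems with time-dependent forms)
applied to the damped weak formulation of the divergence-form system
`∂ₜw + (b·∇)w + ∇π = ∇·(𝔹(t,y)∇w)`, `∇·w = 0` on `T^d × (0,T)` (the `A = 0` class of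
`Torus.IsWeakVarTensorPassiveVectorOn`, `PassiveVectorVarTensor`): for `T > 0`, a tensor FIELD
`𝔹 : ℝ → T^d → Visc4 d` with smooth coefficient slices, `𝔹` and `∂_y𝔹` jointly continuous, entrywise
`δ`-close to a constant Legendre–Hadamard tensor `𝔸` (`NearIso 𝔸 lo hi`, `(card d)² δ ≤ lo`:
perturbative Gårding, `PassiveVectorVarTensorGarding`), a jointly measurable carrier `b` with
`‖b‖ ≤ M` a.e. on `(0,T) × T^d`, weakly divergence free for a.e. `t`, and a datum `w₀ ∈ L²`, there
is `v ∈ L²(μ_T)` in the closed span of the divergence-free space–time tests with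

  `∫_{μ_T} ⟪v, ∂ₜψ − ψ + (b·∇)ψ + 𝓛^{𝔹(t),*} ψ⟫ + ∫⟪w₀, ψ(0)⟫ = 0`  for every divergence-free test `ψ` on `[0,T)`

(`exists_dampedWeakVar_mem_closure`). The four viscous-specific inputs of the constant-tensor proof are
replaced: `memLp_two_dampedOpVar` (the image of a test under the damped operator is in `L²(μ_T)`: joint
continuity of `(t,x) ↦ viscAdjVar (𝔹 t) (ψ t) x`, `continuous_uncurry_viscAdjVar`), `dampedOpVar_add` /
`dampedOpVar_const_smul` (linearity in the test; `viscAdjVar_add_field`), and the coercive space–time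
form `setIntegral_varTensorForm_ge` (time-derivative and transport parts as in the scalar file,
viscous part dissipative by `setIntegral_integral_inner_viscAdjVar_self_nonpos`); the undamping
`undamped_weak_of_dampedVar` (`u = eᵗ v`) is recorded for the sequel. Everything else is Lions'
theorem verbatim (Hilbert space = closure of the span of the tests in `L²(μ_T)`, `Φ` = divergence-free
tests, `E(u,ψ) = −⟪u, L_𝔹ψ⟫`, `q(ψ)² = ‖ψ‖²_{L²(μ_T)} + ½‖ψ(0)‖²`, `L(ψ) = ∫⟪w₀, ψ(0)⟫`).

Consumer: cell `ad-ideate`, K1L_D `stmt-AnomalousDissipation-27980`, lead memo L9 §5 brick Z7α (the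
adapted coarse problem `T_ad`, per refresh window). The upgrade of `eᵗv` to the class (weak
incompressibility from the closure, `L^∞_t L²_x` / `L²_t H¹_x` and the energy inequality) is the
sequel file; for variable coefficients the Fourier-truncation energy argument of the constant case
needs a commutator step (tenure ruling 2026-08-29T02:36:59Z).

## Mathlib / tree search

Tree: `OperatorTheory.LionsProjection.exists_eq_of_coercive`, `PassiveVectorTensorLionsWeak` (template;
private helpers re-copied), `PassiveVectorTestOperator` / `PassiveVectorTensorTestOperator`
(`IsSpaceTimeTest.memLp_two_uncurry`, `memLp_two_convect_test`), `PassiveVectorTestForms`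
(`setIntegral_integral_inner_timeDeriv_self`, `setIntegral_integral_inner_convect_self_eq_zero`,
`integrableOn_integral_inner_of_continuous`, `integrable_inner_convect_self_prod`),
`PassiveVectorTensorDistortedDuality` (`viscAdjVar_const_smul`, `continuous_uncurry_viscAdjVar`),
`PassiveVectorVarTensorGarding` (`isSmooth_viscAdjVar`, `isSmooth_coeff_mul_partialDeriv`,
`setIntegral_integral_inner_viscAdjVar_self_nonpos`). Mathlib: `MeasureTheory.L2.inner_def`,
`Submodule.topologicalClosure`, `memLp_top_of_bound`, `MemLp.mono_exponent`.

## References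

* J.-L. Lions, E. Magenes, *Non-homogeneous boundary value problems and applications* I (1972), Chap. 3,
  Thm. 1.1, Remark 1.3, §4.3–§4.4. [`LionsMagenes1972`]
* M. Giaquinta, *Multiple integrals in the calculus of variations* (Princeton 1983), Ch. III §2. [`Giaquinta1983MultipleIntegrals`]
* S. Armstrong, V. Vicol, arXiv:2305.05048, §4.1 (the adapted equation with `K_m + s_{m−1}`), PDF p. 34. [`ArmstrongVicol2025`]
-/

noncomputable section

open MeasureTheory Set Filter Function TopologicalSpace
open scoped ENNReal NNReal InnerProductSpace Topology

namespace Literature.Analysis.FluidPDE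

namespace Torus

variable {d : Type*} [Fintype d] [DecidableEq d]

/-! ## Divergence-free tests form a subspace (private copies) -/


/-! ## Divergence-free tests form a subspace -/

/-- Smooth divergence-free fields are closed under addition. [folklore] -/
private theorem isDivFree_add₂₉ {u v : UnitAddTorus d → EuclideanSpace ℝ d}
    (hu : FunctionSpaces.Torus.IsSmooth u) (hv : FunctionSpaces.Torus.IsSmooth v)
    (hud : FunctionSpaces.Torus.IsDivFree u) (hvd : FunctionSpaces.Torus.IsDivFree v) :
    FunctionSpaces.Torus.IsDivFree (u + v) := by
  intro x
  have hu1 : ∀ i, FunctionSpaces.Torus.IsContDiff 1 (fun y => u y i) := fun i =>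
    (hu.apply i).isContDiff (by simp)
  have hv1 : ∀ i, FunctionSpaces.Torus.IsContDiff 1 (fun y => v y i) := fun i =>
    (hv.apply i).isContDiff (by simp)
  have h : ∀ i, FunctionSpaces.Torus.partialDeriv i (fun y => (u + v) y i) x =
      FunctionSpaces.Torus.partialDeriv i (fun y => u y i) x + FunctionSpaces.Torus.partialDeriv i (fun y => v y i) x := by
    intro i
    have e : (fun y => (u + v) y i) = (fun y => u y i) + fun y => v y i := by
      funext y; simp
    rw [e, FunctionSpaces.Torus.partialDeriv_add (hu1 i) (hv1 i)]
    rfl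
  unfold FunctionSpaces.Torus.divergence
  simp_rw [h]
  rw [Finset.sum_add_distrib]
  have h0 := hud x
  have h1 := hvd x
  unfold FunctionSpaces.Torus.divergence at h0 h1
  rw [h0, h1, add_zero]

/-- Smooth divergence-free fields: the zero field is divergence free. [folklore] -/
private theorem isDivFree_zero₂₉ : FunctionSpaces.Torus.IsDivFree (0 : UnitAddTorus d → EuclideanSpace ℝ d) := by
  intro x
  simp [FunctionSpaces.Torus.divergence, FunctionSpaces.Torus.partialDeriv, FunctionSpaces.Torus.lineDeriv]

omit [Fintype d] in
/-- `∂ᵢ (c f) = c ∂ᵢ f` for real functions on `T^d`. [folklore] -/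
private theorem partialDeriv_const_mul₂₉ (c : ℝ) (f : UnitAddTorus d → ℝ) (i : d) (x : UnitAddTorus d) :
    FunctionSpaces.Torus.partialDeriv i (fun y => c * f y) x = c * FunctionSpaces.Torus.partialDeriv i f x := by
  simp only [FunctionSpaces.Torus.partialDeriv, FunctionSpaces.Torus.lineDeriv, deriv_const_mul_field']

/-- A constant multiple of a divergence-free field is divergence free. [folklore] -/
private theorem isDivFree_const_smul₂₉ {G : UnitAddTorus d → EuclideanSpace ℝ d}
    (hG : FunctionSpaces.Torus.IsDivFree G) (c : ℝ) : FunctionSpaces.Torus.IsDivFree (c • G) := by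
  intro x
  have h : ∀ i : d, FunctionSpaces.Torus.partialDeriv i (fun y => (c • G) y i) x =
      c * FunctionSpaces.Torus.partialDeriv i (fun y => G y i) x := by
    intro i
    have e : (fun y => (c • G) y i) = fun y => c * G y i := by
      funext y; simp [Pi.smul_apply, smul_eq_mul]
    rw [e, partialDeriv_const_mul₂₉]
  unfold FunctionSpaces.Torus.divergence
  simp_rw [h]
  rw [← Finset.mul_sum]
  have h0 := hG x
  unfold FunctionSpaces.Torus.divergence at h0
  rw [h0, mul_zero]

/-! ## §1 The damped variable-tensor operator on space–time test fields -/

omit [DecidableEq d] in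
/-- Time derivative of `e^{t} • ψ`: `∂ₜ(e^{t}ψ) = e^{t}ψ + e^{t}∂ₜψ`. [folklore] -/
private theorem timeDeriv_exp_smul₂₉ {T : ℝ} {ψ : ℝ → UnitAddTorus d → EuclideanSpace ℝ d}
    (hψ : FunctionSpaces.Torus.IsSpaceTimeTest T ψ) (t : ℝ) (x : UnitAddTorus d) :
    FunctionSpaces.Torus.timeDeriv (fun t x => Real.exp t • ψ t x) t x =
      Real.exp t • ψ t x + Real.exp t • FunctionSpaces.Torus.timeDeriv ψ t x := by
  have hd : HasDerivAt (fun τ => ψ τ x) (FunctionSpaces.Torus.timeDeriv ψ t x) t := by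
    have hdiff : DifferentiableAt ℝ (fun τ => ψ τ x) t := by
      obtain ⟨y, rfl⟩ := FunctionSpaces.Torus.proj_surjective x
      have h : (fun τ : ℝ => ψ τ (FunctionSpaces.Torus.proj y)) = FunctionSpaces.Torus.stLift ψ ∘ fun τ : ℝ => (τ, y) := by
        funext τ; rfl
      rw [h]
      exact ((hψ.1.differentiable (by simp)).differentiableAt).comp t
        (differentiableAt_id.prodMk (differentiableAt_const _))
    exact hdiff.hasDerivAt
  have h := (Real.hasDerivAt_exp t).smul hd
  simp only [FunctionSpaces.Torus.timeDeriv] at h ⊢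
  rw [show (fun τ => Real.exp τ • ψ τ x) = (Real.exp • fun τ => ψ τ x) from rfl, h.deriv, add_comm]

omit [DecidableEq d] in
/-- `(u·∇)(c • G) = c • (u·∇)G` for a `C¹` field. [folklore] -/
private theorem convect_const_smul₂₉ {G : UnitAddTorus d → EuclideanSpace ℝ d} (hG : FunctionSpaces.Torus.IsContDiff 1 G)
    (c : ℝ) (u : UnitAddTorus d → EuclideanSpace ℝ d) (x : UnitAddTorus d) :
    FunctionSpaces.Torus.convect u (c • G) x = c • FunctionSpaces.Torus.convect u G x := by
  simp only [FunctionSpaces.Torus.convect]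
  rw [FunctionSpaces.Torus.fderiv_const_smul hG]
  rfl

omit [DecidableEq d] in
/-- A space–time test field is differentiable in time at every point (slice of the smooth lift). [folklore] -/
private theorem hasDerivAt_slice_test₂₉ {T : ℝ} {ψ : ℝ → UnitAddTorus d → EuclideanSpace ℝ d}
    (hψ : FunctionSpaces.Torus.IsSpaceTimeTest T ψ) (t : ℝ) (x : UnitAddTorus d) :
    HasDerivAt (fun τ => ψ τ x) (FunctionSpaces.Torus.timeDeriv ψ t x) t := by
  have hdiff : DifferentiableAt ℝ (fun τ => ψ τ x) t := by
    obtain ⟨y, rfl⟩ := FunctionSpaces.Torus.proj_surjective x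
    have h : (fun τ : ℝ => ψ τ (FunctionSpaces.Torus.proj y)) = FunctionSpaces.Torus.stLift ψ ∘ fun τ : ℝ => (τ, y) := by
      funext τ; rfl
    rw [h]
    exact ((hψ.1.differentiable (by simp)).differentiableAt).comp t
      (differentiableAt_id.prodMk (differentiableAt_const _))
  exact hdiff.hasDerivAt

omit [DecidableEq d] in
/-- `∂ₜ(ψ + χ) = ∂ₜψ + ∂ₜχ` for space–time test fields. [folklore] -/
private theorem timeDeriv_add_test₂₉ {T : ℝ} {ψ χ : ℝ → UnitAddTorus d → EuclideanSpace ℝ d}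
    (hψ : FunctionSpaces.Torus.IsSpaceTimeTest T ψ) (hχ : FunctionSpaces.Torus.IsSpaceTimeTest T χ)
    (t : ℝ) (x : UnitAddTorus d) :
    FunctionSpaces.Torus.timeDeriv (ψ + χ) t x = FunctionSpaces.Torus.timeDeriv ψ t x + FunctionSpaces.Torus.timeDeriv χ t x := by
  have h := (hasDerivAt_slice_test₂₉ hψ t x).add (hasDerivAt_slice_test₂₉ hχ t x)
  simp only [FunctionSpaces.Torus.timeDeriv] at h ⊢
  exact h.deriv

omit [DecidableEq d] in
/-- `∂ₜ(c • ψ) = c • ∂ₜψ` for a space–time test field. [folklore] -/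
private theorem timeDeriv_const_smul_test₂₉ {T : ℝ} {ψ : ℝ → UnitAddTorus d → EuclideanSpace ℝ d}
    (hψ : FunctionSpaces.Torus.IsSpaceTimeTest T ψ) (c : ℝ) (t : ℝ) (x : UnitAddTorus d) :
    FunctionSpaces.Torus.timeDeriv (c • ψ) t x = c • FunctionSpaces.Torus.timeDeriv ψ t x := by
  have h := (hasDerivAt_slice_test₂₉ hψ t x).const_smul c
  simp only [FunctionSpaces.Torus.timeDeriv] at h ⊢
  exact h.deriv

omit [DecidableEq d] in
/-- A jointly continuous space–time field is in `L²((0,T) × T^d)` (bounded on the compact `[0,T] × T^d`).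
[cite: LionsMagenes1972, Chap. 3 §4.3] -/
theorem memLp_two_uncurry_of_continuous_uncurry {T : ℝ} {V : ℝ → UnitAddTorus d → EuclideanSpace ℝ d}
    (hV : Continuous (uncurry V)) :
    MemLp (uncurry V) 2 (((volume : Measure ℝ).restrict (Ioo 0 T)).prod volume) := by
  obtain ⟨C, hC⟩ := exists_bound_of_continuous_uncurry hV 0 T
  have hae : ∀ᵐ p : ℝ × UnitAddTorus d ∂(((volume : Measure ℝ).restrict (Ioo 0 T)).prod volume), p.1 ∈ Ioo 0 T :=
    (Measure.quasiMeasurePreserving_fst (μ := (volume : Measure ℝ).restrict (Ioo 0 T))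
      (ν := (volume : Measure (UnitAddTorus d)))).ae (ae_restrict_mem measurableSet_Ioo)
  have htop : MemLp (uncurry V) ∞ (((volume : Measure ℝ).restrict (Ioo 0 T)).prod volume) := by
    refine memLp_top_of_bound hV.aestronglyMeasurable C ?_
    filter_upwards [hae] with p hp
    exact hC p.1 (Ioo_subset_Icc_self hp) p.2
  exact htop.mono_exponent le_top

/-- **`viscAdjVar` is additive in the TEST field** (coefficients `C¹` in space, smooth tests):
`𝓛^{𝔹,*}(Ψ + χ) = 𝓛^{𝔹,*}Ψ + 𝓛^{𝔹,*}χ` pointwise. [cite: Giaquinta1983MultipleIntegrals, Ch. III §2 eq. (2.1)-(2.3)] -/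
theorem viscAdjVar_add_field {𝔹 : UnitAddTorus d → Visc4 d}
    (h𝔹 : ∀ i c j e, FunctionSpaces.Torus.IsSmooth (fun y => 𝔹 y i c j e))
    {Ψ χ : UnitAddTorus d → EuclideanSpace ℝ d} (hΨ : FunctionSpaces.Torus.IsSmooth Ψ)
    (hχ : FunctionSpaces.Torus.IsSmooth χ) (x : UnitAddTorus d) :
    viscAdjVar 𝔹 (Ψ + χ) x = viscAdjVar 𝔹 Ψ x + viscAdjVar 𝔹 χ x := by
  ext l
  rw [PiLp.add_apply, viscAdjVar_apply, viscAdjVar_apply, viscAdjVar_apply, ← Finset.sum_add_distrib]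
  refine Finset.sum_congr rfl fun i _ => ?_
  rw [← Finset.sum_add_distrib]
  refine Finset.sum_congr rfl fun c _ => ?_
  rw [← Finset.sum_add_distrib]
  refine Finset.sum_congr rfl fun e _ => ?_
  have hd : FunctionSpaces.Torus.partialDeriv c (Ψ + χ) =
      FunctionSpaces.Torus.partialDeriv c Ψ + FunctionSpaces.Torus.partialDeriv c χ :=
    FunctionSpaces.Torus.partialDeriv_add (hΨ.isContDiff (by simp)) (hχ.isContDiff (by simp)) c
  have e1 : (fun y => 𝔹 y i c l e * (FunctionSpaces.Torus.partialDeriv c (Ψ + χ) y) i) =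
      (fun y => 𝔹 y i c l e * (FunctionSpaces.Torus.partialDeriv c Ψ y) i) +
        fun y => 𝔹 y i c l e * (FunctionSpaces.Torus.partialDeriv c χ y) i := by
    funext y
    rw [hd]
    simp only [Pi.add_apply, PiLp.add_apply, mul_add]
  have h1 : FunctionSpaces.Torus.IsContDiff 1 (fun y => 𝔹 y i c l e * (FunctionSpaces.Torus.partialDeriv c Ψ y) i) :=
    (isSmooth_coeff_mul_partialDeriv h𝔹 hΨ i c l e).isContDiff (by simp)
  have h2 : FunctionSpaces.Torus.IsContDiff 1 (fun y => 𝔹 y i c l e * (FunctionSpaces.Torus.partialDeriv c χ y) i) :=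
    (isSmooth_coeff_mul_partialDeriv h𝔹 hχ i c l e).isContDiff (by simp)
  rw [e1, FunctionSpaces.Torus.partialDeriv_add h1 h2, Pi.add_apply]

/-- **The image of a test field under the damped VARIABLE-tensor operator is in `L²(μ_T)`**:
`(t,x) ↦ ∂ₜψ − ψ + (b·∇)ψ + 𝓛^{𝔹(t),*}ψ` for a space–time test `ψ`, a carrier bounded a.e. on
`(0,T) × T^d`, and coefficients with smooth slices, `𝔹` and `∂_y𝔹` jointly continuous.
[cite: LionsMagenes1972, Chap. 3 §4.3] -/
theorem memLp_two_dampedOpVar {T : ℝ} {𝔹 : ℝ → UnitAddTorus d → Visc4 d}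
    (h𝔹s : ∀ t i c j e, FunctionSpaces.Torus.IsSmooth (fun y => 𝔹 t y i c j e))
    (h𝔹c : ∀ i c j e, Continuous (uncurry fun t y => 𝔹 t y i c j e))
    (h𝔹d : ∀ i c j e e', Continuous (uncurry fun t y =>
      FunctionSpaces.Torus.partialDeriv e' (fun y => 𝔹 t y i c j e) y))
    {b ψ : ℝ → UnitAddTorus d → EuclideanSpace ℝ d}
    (hψ : FunctionSpaces.Torus.IsSpaceTimeTest T ψ)
    (hbm : AEStronglyMeasurable (uncurry b) (((volume : Measure ℝ).restrict (Ioo 0 T)).prod volume)) {M : ℝ}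
    (hbM : ∀ᵐ p ∂(((volume : Measure ℝ).restrict (Ioo 0 T)).prod (volume : Measure (UnitAddTorus d))),
      ‖uncurry b p‖ ≤ M) :
    MemLp (fun p : ℝ × UnitAddTorus d => FunctionSpaces.Torus.timeDeriv ψ p.1 p.2 - ψ p.1 p.2 +
        FunctionSpaces.Torus.convect (b p.1) (ψ p.1) p.2 + viscAdjVar (𝔹 p.1) (ψ p.1) p.2) 2
      (((volume : Measure ℝ).restrict (Ioo 0 T)).prod volume) := by
  have h1 : MemLp (uncurry (FunctionSpaces.Torus.timeDeriv ψ)) 2 (((volume : Measure ℝ).restrict (Ioo 0 T)).prod volume) :=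
    hψ.timeDeriv.memLp_two_uncurry
  have h2 := hψ.memLp_two_uncurry
  have h3 := memLp_two_convect_test hψ hbm hbM
  have hVc : Continuous (uncurry fun t x => viscAdjVar (𝔹 t) (ψ t) x) :=
    continuous_uncurry_viscAdjVar (fun t i c l e => (h𝔹s t i c l e).isContDiff (by simp)) h𝔹c h𝔹d
      hψ.isSmooth_slice hψ.isLipschitzSpaceTimeTest.continuous_uncurry_iterPartialDeriv
  have h4 : MemLp (uncurry fun t x => viscAdjVar (𝔹 t) (ψ t) x) 2 (((volume : Measure ℝ).restrict (Ioo 0 T)).prod volume) :=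
    memLp_two_uncurry_of_continuous_uncurry hVc
  exact ((h1.sub h2).add h3).add h4

/-- **The damped variable-tensor operator is additive in the test field**:
`L(ψ + χ) = Lψ + Lχ` pointwise, `Lψ = ∂ₜψ − ψ + (b·∇)ψ + 𝓛^{𝔹(t),*}ψ`. [cite: LionsMagenes1972, Chap. 3 §4.3] -/
theorem dampedOpVar_add {T : ℝ} {𝔹 : ℝ → UnitAddTorus d → Visc4 d}
    (h𝔹s : ∀ t i c j e, FunctionSpaces.Torus.IsSmooth (fun y => 𝔹 t y i c j e))
    {b ψ χ : ℝ → UnitAddTorus d → EuclideanSpace ℝ d}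
    (hψ : FunctionSpaces.Torus.IsSpaceTimeTest T ψ) (hχ : FunctionSpaces.Torus.IsSpaceTimeTest T χ)
    (p : ℝ × UnitAddTorus d) :
    FunctionSpaces.Torus.timeDeriv (ψ + χ) p.1 p.2 - (ψ + χ) p.1 p.2 +
        FunctionSpaces.Torus.convect (b p.1) ((ψ + χ) p.1) p.2 + viscAdjVar (𝔹 p.1) ((ψ + χ) p.1) p.2 =
      (FunctionSpaces.Torus.timeDeriv ψ p.1 p.2 - ψ p.1 p.2 +
          FunctionSpaces.Torus.convect (b p.1) (ψ p.1) p.2 + viscAdjVar (𝔹 p.1) (ψ p.1) p.2) +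
        (FunctionSpaces.Torus.timeDeriv χ p.1 p.2 - χ p.1 p.2 +
          FunctionSpaces.Torus.convect (b p.1) (χ p.1) p.2 + viscAdjVar (𝔹 p.1) (χ p.1) p.2) := by
  have hψ1 : FunctionSpaces.Torus.IsContDiff 1 (ψ p.1) := (hψ.isSmooth_slice p.1).isContDiff (by simp)
  have hχ1 : FunctionSpaces.Torus.IsContDiff 1 (χ p.1) := (hχ.isSmooth_slice p.1).isContDiff (by simp)
  rw [timeDeriv_add_test₂₉ hψ hχ, show (ψ + χ) p.1 = ψ p.1 + χ p.1 from rfl,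
    viscAdjVar_add_field (h𝔹s p.1) (hψ.isSmooth_slice p.1) (hχ.isSmooth_slice p.1)]
  simp only [FunctionSpaces.Torus.convect, Pi.add_apply]
  rw [FunctionSpaces.Torus.fderiv_add hψ1 hχ1]
  simp only [FunLike.coe_add, Pi.add_apply]
  abel

/-- **The damped variable-tensor operator is homogeneous in the test field**: `L(c • ψ) = c • Lψ` pointwise.
[cite: LionsMagenes1972, Chap. 3 §4.3] -/
theorem dampedOpVar_const_smul {T : ℝ} (𝔹 : ℝ → UnitAddTorus d → Visc4 d)
    {b ψ : ℝ → UnitAddTorus d → EuclideanSpace ℝ d}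
    (hψ : FunctionSpaces.Torus.IsSpaceTimeTest T ψ) (c : ℝ) (p : ℝ × UnitAddTorus d) :
    FunctionSpaces.Torus.timeDeriv (c • ψ) p.1 p.2 - (c • ψ) p.1 p.2 +
        FunctionSpaces.Torus.convect (b p.1) ((c • ψ) p.1) p.2 + viscAdjVar (𝔹 p.1) ((c • ψ) p.1) p.2 =
      c • (FunctionSpaces.Torus.timeDeriv ψ p.1 p.2 - ψ p.1 p.2 +
        FunctionSpaces.Torus.convect (b p.1) (ψ p.1) p.2 + viscAdjVar (𝔹 p.1) (ψ p.1) p.2) := by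
  have hψ1 : FunctionSpaces.Torus.IsContDiff 1 (ψ p.1) := (hψ.isSmooth_slice p.1).isContDiff (by simp)
  rw [timeDeriv_const_smul_test₂₉ hψ, show (c • ψ) p.1 = c • ψ p.1 from rfl, convect_const_smul₂₉ hψ1,
    show c • ψ p.1 = fun y => c • ψ p.1 y from rfl, viscAdjVar_const_smul (𝔹 p.1) hψ1 c]
  simp only [smul_add, smul_sub]

/-- **Undamping (variable tensor).** If `v` satisfies the damped weak identity
`∫_{μ_T}⟪v, ∂ₜψ - ψ + (b·∇)ψ + 𝓛^{𝔹(t),*}ψ⟫ + ∫⟪w₀, ψ(0)⟫ = 0` for all divergence-free space–time tests `ψ`,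
then `u = e^{t} v` satisfies the undamped one (test with `e^{t}ψ`). [cite: LionsMagenes1972, Chap. 3 §4.3] -/
theorem undamped_weak_of_dampedVar {T : ℝ} (𝔹 : ℝ → UnitAddTorus d → Visc4 d) {b : ℝ → UnitAddTorus d → EuclideanSpace ℝ d}
    {v : ℝ × UnitAddTorus d → EuclideanSpace ℝ d} {w₀ : UnitAddTorus d → EuclideanSpace ℝ d}
    (hdamped : ∀ ψ : ℝ → UnitAddTorus d → EuclideanSpace ℝ d, FunctionSpaces.Torus.IsSpaceTimeTest T ψ →
      FunctionSpaces.Torus.IsDivFreeTest ψ →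
      (∫ p, ⟪v p, FunctionSpaces.Torus.timeDeriv ψ p.1 p.2 - ψ p.1 p.2 +
          FunctionSpaces.Torus.convect (b p.1) (ψ p.1) p.2 + viscAdjVar (𝔹 p.1) (ψ p.1) p.2⟫_ℝ
          ∂(((volume : Measure ℝ).restrict (Ioo 0 T)).prod volume)) + ∫ x, ⟪w₀ x, ψ 0 x⟫_ℝ = 0)
    {ψ : ℝ → UnitAddTorus d → EuclideanSpace ℝ d} (hψ : FunctionSpaces.Torus.IsSpaceTimeTest T ψ)
    (hdiv : FunctionSpaces.Torus.IsDivFreeTest ψ) :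
    (∫ p, ⟪Real.exp p.1 • v p, FunctionSpaces.Torus.timeDeriv ψ p.1 p.2 +
        FunctionSpaces.Torus.convect (b p.1) (ψ p.1) p.2 + viscAdjVar (𝔹 p.1) (ψ p.1) p.2⟫_ℝ
        ∂(((volume : Measure ℝ).restrict (Ioo 0 T)).prod volume)) + ∫ x, ⟪w₀ x, ψ 0 x⟫_ℝ = 0 := by
  have hΨ := hψ.exp_smul
  have hΨdiv : FunctionSpaces.Torus.IsDivFreeTest (fun t x => Real.exp t • ψ t x) := fun t => by
    show FunctionSpaces.Torus.IsDivFree (Real.exp t • ψ t)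
    exact isDivFree_const_smul₂₉ (hdiv t) _
  have key := hdamped _ hΨ hΨdiv
  have hψ1 : ∀ t, FunctionSpaces.Torus.IsContDiff 1 (ψ t) := fun t => (hψ.isSmooth_slice t).isContDiff (by simp)
  have hpt : ∀ p : ℝ × UnitAddTorus d,
      ⟪v p, FunctionSpaces.Torus.timeDeriv (fun t x => Real.exp t • ψ t x) p.1 p.2 - Real.exp p.1 • ψ p.1 p.2 +
          FunctionSpaces.Torus.convect (b p.1) ((fun t x => Real.exp t • ψ t x) p.1) p.2 +
          viscAdjVar (𝔹 p.1) ((fun t x => Real.exp t • ψ t x) p.1) p.2⟫_ℝ =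
        ⟪Real.exp p.1 • v p, FunctionSpaces.Torus.timeDeriv ψ p.1 p.2 +
          FunctionSpaces.Torus.convect (b p.1) (ψ p.1) p.2 + viscAdjVar (𝔹 p.1) (ψ p.1) p.2⟫_ℝ := by
    intro p
    rw [timeDeriv_exp_smul₂₉ hψ, show ((fun t x => Real.exp t • ψ t x) p.1) = Real.exp p.1 • ψ p.1 from rfl,
      convect_const_smul₂₉ (hψ1 p.1), show Real.exp p.1 • ψ p.1 = fun y => Real.exp p.1 • ψ p.1 y from rfl,
      viscAdjVar_const_smul (𝔹 p.1) (hψ1 p.1) (Real.exp p.1)]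
    rw [real_inner_smul_left, ← real_inner_smul_right]
    congr 1
    rw [smul_add, smul_add]
    abel
  have e0 : (fun x => ⟪w₀ x, (fun t x => Real.exp t • ψ t x) 0 x⟫_ℝ) = fun x => ⟪w₀ x, ψ 0 x⟫_ℝ := by
    funext x
    simp
  rw [integral_congr_ae (ae_of_all _ hpt), e0] at key
  exact key

/-! ## Linearity of the damped operator in the test field -/


/-! ## §2 The coercive space–time form -/

/-- **Coercivity of the damped VARIABLE-tensor passive-vector form on divergence-free tests**
(Lions–Magenes 1972, Chap. 3, (4.19)–(4.21), with `νΔ` replaced by the divergence-form `𝓛^{𝔹(t),*}` — VARIABLE coefficients, dissipative by the perturbative Gårding inequality): for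
`T > 0`, `NearIso 𝔸 lo hi`, `|𝔹 − 𝔸| ≤ δ` entrywise with `(card d)²δ ≤ lo`, a carrier `b` bounded a.e. on `(0,T) × T^d` and weakly
divergence free for a.e. `t`, and a divergence-free space–time test `ψ` on `[0,T)`,
`∫_{(0,T)}∫‖ψ‖² + ½∫‖ψ(0)‖² ≤ -∫_{(0,T)} ∫ ⟪ψ, ∂ₜψ - ψ + (b·∇)ψ + 𝓛^{𝔹,*} ψ⟫`.
[cite: LionsMagenes1972, Chap. 3 Thm. 1.1 and §4.3] -/
theorem setIntegral_varTensorForm_ge {T : ℝ} (hT : 0 < T) {𝔸 : Visc4 d} {lo hi : ℝ} (h𝔸 : NearIso 𝔸 lo hi)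
    {𝔹 : ℝ → UnitAddTorus d → Visc4 d}
    (h𝔹s : ∀ t i c j e, FunctionSpaces.Torus.IsSmooth (fun y => 𝔹 t y i c j e))
    (h𝔹c : ∀ i c j e, Continuous (uncurry fun t y => 𝔹 t y i c j e))
    (h𝔹d : ∀ i c j e e', Continuous (uncurry fun t y =>
      FunctionSpaces.Torus.partialDeriv e' (fun y => 𝔹 t y i c j e) y))
    {δ : ℝ} (hδ : ∀ t y i c j e, |𝔹 t y i c j e - 𝔸 i c j e| ≤ δ) (hlo : (Fintype.card d : ℝ) ^ 2 * δ ≤ lo)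
    {b ψ : ℝ → UnitAddTorus d → EuclideanSpace ℝ d} (hψ : FunctionSpaces.Torus.IsSpaceTimeTest T ψ)
    (hψdiv : FunctionSpaces.Torus.IsDivFreeTest ψ)
    (hbdiv : ∀ᵐ t ∂(volume.restrict (Ioo 0 T)), FunctionSpaces.Torus.IsWeaklyDivFree (b t))
    (hbm : AEStronglyMeasurable (uncurry b) (((volume : Measure ℝ).restrict (Ioo 0 T)).prod volume)) {M : ℝ}
    (hbM : ∀ᵐ p ∂(((volume : Measure ℝ).restrict (Ioo 0 T)).prod (volume : Measure (UnitAddTorus d))),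
      ‖uncurry b p‖ ≤ M) :
    (∫ t in Ioo 0 T, ∫ x, ‖ψ t x‖ ^ 2) + (1 / 2) * ∫ x, ‖ψ 0 x‖ ^ 2 ≤
      -(∫ t in Ioo 0 T, ∫ x, ⟪ψ t x, FunctionSpaces.Torus.timeDeriv ψ t x - ψ t x +
          FunctionSpaces.Torus.convect (b t) (ψ t) x + viscAdjVar (𝔹 t) (ψ t) x⟫_ℝ) := by
  -- slice integrability
  have hcψ : Continuous (uncurry ψ) := hψ.continuous_uncurry
  have hVc : Continuous (uncurry fun t x => viscAdjVar (𝔹 t) (ψ t) x) :=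
    continuous_uncurry_viscAdjVar (fun t i c l e => (h𝔹s t i c l e).isContDiff (by simp)) h𝔹c h𝔹d
      hψ.isSmooth_slice hψ.isLipschitzSpaceTimeTest.continuous_uncurry_iterPartialDeriv
  have iA : ∀ t, Integrable (fun x => ⟪ψ t x, FunctionSpaces.Torus.timeDeriv ψ t x⟫_ℝ) volume := fun t =>
    ((hψ.isSmooth_slice t).continuous.inner (hψ.timeDeriv.isSmooth_slice t).continuous).integrable_of_hasCompactSupport
      (HasCompactSupport.of_compactSpace _)
  have iS : ∀ t, Integrable (fun x => ⟪ψ t x, ψ t x⟫_ℝ) volume := fun t =>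
    ((hψ.isSmooth_slice t).continuous.inner (hψ.isSmooth_slice t).continuous).integrable_of_hasCompactSupport
      (HasCompactSupport.of_compactSpace _)
  have iL : ∀ t, Integrable (fun x => ⟪ψ t x, viscAdjVar (𝔹 t) (ψ t) x⟫_ℝ) volume := fun t =>
    ((hψ.isSmooth_slice t).continuous.inner (isSmooth_viscAdjVar (h𝔹s t) (hψ.isSmooth_slice t)).continuous).integrable_of_hasCompactSupport
      (HasCompactSupport.of_compactSpace _)
  have hprod := integrable_inner_convect_self_prod hψ hbm hbM
  have iC : ∀ᵐ t ∂(volume.restrict (Ioo 0 T)),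
      Integrable (fun x => ⟪ψ t x, FunctionSpaces.Torus.convect (b t) (ψ t) x⟫_ℝ) volume := hprod.prod_right_ae
  -- the slice identity
  have hslice : ∀ᵐ t ∂(volume.restrict (Ioo 0 T)),
      ∫ x, ⟪ψ t x, FunctionSpaces.Torus.timeDeriv ψ t x - ψ t x +
          FunctionSpaces.Torus.convect (b t) (ψ t) x + viscAdjVar (𝔹 t) (ψ t) x⟫_ℝ =
        (∫ x, ⟪ψ t x, FunctionSpaces.Torus.timeDeriv ψ t x⟫_ℝ) - (∫ x, ‖ψ t x‖ ^ 2) +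
          (∫ x, ⟪ψ t x, FunctionSpaces.Torus.convect (b t) (ψ t) x⟫_ℝ) +
            ∫ x, ⟪ψ t x, viscAdjVar (𝔹 t) (ψ t) x⟫_ℝ := by
    filter_upwards [iC] with t ht
    have e : (fun x => ⟪ψ t x, FunctionSpaces.Torus.timeDeriv ψ t x - ψ t x +
        FunctionSpaces.Torus.convect (b t) (ψ t) x + viscAdjVar (𝔹 t) (ψ t) x⟫_ℝ) =
        fun x => ⟪ψ t x, FunctionSpaces.Torus.timeDeriv ψ t x⟫_ℝ - ⟪ψ t x, ψ t x⟫_ℝ +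
          ⟪ψ t x, FunctionSpaces.Torus.convect (b t) (ψ t) x⟫_ℝ + ⟪ψ t x, viscAdjVar (𝔹 t) (ψ t) x⟫_ℝ := by
      funext x
      rw [inner_add_right, inner_add_right, inner_sub_right]
    have h12 : Integrable (fun x => ⟪ψ t x, FunctionSpaces.Torus.timeDeriv ψ t x⟫_ℝ - ⟪ψ t x, ψ t x⟫_ℝ) volume :=
      (iA t).sub (iS t)
    have h123 : Integrable (fun x => ⟪ψ t x, FunctionSpaces.Torus.timeDeriv ψ t x⟫_ℝ - ⟪ψ t x, ψ t x⟫_ℝ +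
        ⟪ψ t x, FunctionSpaces.Torus.convect (b t) (ψ t) x⟫_ℝ) volume := h12.add ht
    rw [e, integral_add h123 (iL t), integral_add h12 ht, integral_sub (iA t) (iS t),
      integral_congr_ae (ae_of_all _ fun x => real_inner_self_eq_norm_sq (ψ t x))]
  -- time integrability of the four slice terms
  have IA : IntegrableOn (fun t => ∫ x, ⟪ψ t x, FunctionSpaces.Torus.timeDeriv ψ t x⟫_ℝ) (Ioo 0 T) :=
    integrableOn_integral_inner_of_continuous hψ hψ.timeDeriv.continuous_uncurry
  have IS : IntegrableOn (fun t => ∫ x, ‖ψ t x‖ ^ 2) (Ioo 0 T) := by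
    refine (integrableOn_integral_inner_of_continuous hψ hcψ).congr (ae_of_all _ fun t => ?_)
    exact integral_congr_ae (ae_of_all _ fun x => real_inner_self_eq_norm_sq (ψ t x))
  have IC : IntegrableOn (fun t => ∫ x, ⟪ψ t x, FunctionSpaces.Torus.convect (b t) (ψ t) x⟫_ℝ) (Ioo 0 T) :=
    hprod.integral_prod_left
  have IL : IntegrableOn (fun t => ∫ x, ⟪ψ t x, viscAdjVar (𝔹 t) (ψ t) x⟫_ℝ) (Ioo 0 T) :=
    integrableOn_integral_inner_of_continuous hψ hVc
  -- assemble
  have H12 : IntegrableOn (fun t => (∫ x, ⟪ψ t x, FunctionSpaces.Torus.timeDeriv ψ t x⟫_ℝ) - ∫ x, ‖ψ t x‖ ^ 2) (Ioo 0 T) :=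
    IA.sub IS
  have H123 : IntegrableOn (fun t => (∫ x, ⟪ψ t x, FunctionSpaces.Torus.timeDeriv ψ t x⟫_ℝ) - (∫ x, ‖ψ t x‖ ^ 2) +
      ∫ x, ⟪ψ t x, FunctionSpaces.Torus.convect (b t) (ψ t) x⟫_ℝ) (Ioo 0 T) := H12.add IC
  rw [integral_congr_ae hslice, integral_add H123 IL, integral_add H12 IC, integral_sub IA IS,
    setIntegral_integral_inner_timeDeriv_self hψ hT, setIntegral_integral_inner_convect_self_eq_zero hψ hbdiv]
  have hL0 := setIntegral_integral_inner_viscAdjVar_self_nonpos h𝔸 h𝔹s hδ hlo hψ hψdiv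
  linarith


/-! ## §3 Lions' theorem applied: a damped `L²` weak solution in the closed span of the tests -/


/-! ## Lions' theorem applied: a damped `L²` weak solution in the closed span of the tests -/

/-- **Damped `L²` weak solutions of the VARIABLE-tensor passive-vector equation exist** (J.-L. Lions' projection theorem in the
closed span `F ⊆ L²(μ_T)` of the divergence-free space–time tests): for `T > 0`, a coefficient field `𝔹` (smooth slices; `𝔹`, `∂_y𝔹` jointly continuous) entrywise
`δ`-close to `𝔸`, `NearIso 𝔸 lo hi`, `(card d)²δ ≤ lo`, `‖b‖ ≤ M` a.e. on
`(0,T) × T^d` with `b(t)` weakly divergence free for a.e. `t`, and `w₀ ∈ L²`, there is `v ∈ F` with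
`∫_{μ_T}⟪v, ∂ₜψ - ψ + (b·∇)ψ + 𝓛^{𝔹(t),*}ψ⟫ + ∫⟪w₀, ψ(0)⟫ = 0` for all divergence-free tests `ψ`
(the perturbative Gårding inequality on divergence-free tests gives the coercivity).
[cite: LionsMagenes1972, Chap. 3 Thm. 1.1] -/
theorem exists_dampedWeakVar_mem_closure {T : ℝ} (hT : 0 < T) {𝔸 : Visc4 d} {lo hi : ℝ} (h𝔸 : NearIso 𝔸 lo hi)
    {𝔹 : ℝ → UnitAddTorus d → Visc4 d}
    (h𝔹s : ∀ t i c j e, FunctionSpaces.Torus.IsSmooth (fun y => 𝔹 t y i c j e))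
    (h𝔹c : ∀ i c j e, Continuous (uncurry fun t y => 𝔹 t y i c j e))
    (h𝔹d : ∀ i c j e e', Continuous (uncurry fun t y =>
      FunctionSpaces.Torus.partialDeriv e' (fun y => 𝔹 t y i c j e) y))
    {δ : ℝ} (hδ : ∀ t y i c j e, |𝔹 t y i c j e - 𝔸 i c j e| ≤ δ) (hlo : (Fintype.card d : ℝ) ^ 2 * δ ≤ lo)
    {b : ℝ → UnitAddTorus d → EuclideanSpace ℝ d}
    (hbm : AEStronglyMeasurable (uncurry b) (((volume : Measure ℝ).restrict (Ioo 0 T)).prod volume)) {M : ℝ}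
    (hbM : ∀ᵐ p ∂(((volume : Measure ℝ).restrict (Ioo 0 T)).prod (volume : Measure (UnitAddTorus d))),
      ‖uncurry b p‖ ≤ M)
    (hbdiv : ∀ᵐ t ∂(volume.restrict (Ioo 0 T)), FunctionSpaces.Torus.IsWeaklyDivFree (b t))
    {w₀ : UnitAddTorus d → EuclideanSpace ℝ d} (hw₀ : MemLp w₀ 2 volume) :
    ∃ v : Lp (EuclideanSpace ℝ d) 2 (((volume : Measure ℝ).restrict (Ioo 0 T)).prod (volume : Measure (UnitAddTorus d))),
      v ∈ (Submodule.span ℝ {f : Lp (EuclideanSpace ℝ d) 2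
            (((volume : Measure ℝ).restrict (Ioo 0 T)).prod (volume : Measure (UnitAddTorus d))) |
          ∃ ψ : ℝ → UnitAddTorus d → EuclideanSpace ℝ d, FunctionSpaces.Torus.IsSpaceTimeTest T ψ ∧
            FunctionSpaces.Torus.IsDivFreeTest ψ ∧
            (f : ℝ × UnitAddTorus d → EuclideanSpace ℝ d) =ᵐ[((volume : Measure ℝ).restrict (Ioo 0 T)).prod volume] uncurry ψ}).topologicalClosure ∧
      ∀ ψ : ℝ → UnitAddTorus d → EuclideanSpace ℝ d, FunctionSpaces.Torus.IsSpaceTimeTest T ψ →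
        FunctionSpaces.Torus.IsDivFreeTest ψ →
        (∫ p, ⟪(v : ℝ × UnitAddTorus d → EuclideanSpace ℝ d) p,
            FunctionSpaces.Torus.timeDeriv ψ p.1 p.2 - ψ p.1 p.2 + FunctionSpaces.Torus.convect (b p.1) (ψ p.1) p.2 +
              viscAdjVar (𝔹 p.1) (ψ p.1) p.2⟫_ℝ ∂(((volume : Measure ℝ).restrict (Ioo 0 T)).prod volume)) +
          ∫ x, ⟪w₀ x, ψ 0 x⟫_ℝ = 0 := by
  set μ : Measure (ℝ × UnitAddTorus d) := ((volume : Measure ℝ).restrict (Ioo 0 T)).prod volume with hμ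
  -- ### the test space as a real vector space
  let S : Submodule ℝ (ℝ → UnitAddTorus d → EuclideanSpace ℝ d) :=
    { carrier := {ψ | FunctionSpaces.Torus.IsSpaceTimeTest T ψ ∧ FunctionSpaces.Torus.IsDivFreeTest ψ}
      add_mem' := fun {ψ χ} hψ hχ => ⟨hψ.1.add hχ.1, fun t =>
        isDivFree_add₂₉ (hψ.1.isSmooth_slice t) (hχ.1.isSmooth_slice t) (hψ.2 t) (hχ.2 t)⟩
      zero_mem' := ⟨FunctionSpaces.Torus.isSpaceTimeTest_zero T, fun t => isDivFree_zero₂₉⟩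
      smul_mem' := fun c ψ hψ => ⟨hψ.1.smul c, fun t => isDivFree_const_smul₂₉ (hψ.2 t) c⟩ }
  have hS : ∀ ψ : S, FunctionSpaces.Torus.IsSpaceTimeTest T (ψ : ℝ → UnitAddTorus d → EuclideanSpace ℝ d) ∧
      FunctionSpaces.Torus.IsDivFreeTest (ψ : ℝ → UnitAddTorus d → EuclideanSpace ℝ d) := fun ψ => ψ.2
  -- ### the Hilbert space and the embedding of the tests
  have memj : ∀ ψ : S, MemLp (uncurry (ψ : ℝ → UnitAddTorus d → EuclideanSpace ℝ d)) 2 μ := fun ψ =>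
    (hS ψ).1.memLp_two_uncurry
  let j₀ : S → Lp (EuclideanSpace ℝ d) 2 μ := fun ψ => (memj ψ).toLp _
  let Fsub : Submodule ℝ (Lp (EuclideanSpace ℝ d) 2 μ) := (Submodule.span ℝ (Set.range j₀)).topologicalClosure
  haveI hFclosed : IsClosed (Fsub : Set (Lp (EuclideanSpace ℝ d) 2 μ)) := Submodule.isClosed_topologicalClosure _
  haveI : CompleteSpace Fsub := hFclosed.completeSpace_coe
  have hj₀mem : ∀ ψ, j₀ ψ ∈ Fsub := fun ψ =>
    Submodule.le_topologicalClosure _ (Submodule.subset_span ⟨ψ, rfl⟩)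
  have hj₀add : ∀ ψ χ : S, j₀ (ψ + χ) = j₀ ψ + j₀ χ := by
    intro ψ χ
    rw [← MemLp.toLp_add]
    rfl
  have hj₀smul : ∀ (c : ℝ) (ψ : S), j₀ (c • ψ) = c • j₀ ψ := by
    intro c ψ
    rw [← MemLp.toLp_const_smul]
    rfl
  let j : S →ₗ[ℝ] Fsub :=
    { toFun := fun ψ => ⟨j₀ ψ, hj₀mem ψ⟩
      map_add' := fun ψ χ => Subtype.ext (hj₀add ψ χ)
      map_smul' := fun c ψ => Subtype.ext (hj₀smul c ψ) }
  -- ### the images of the tests under the damped operator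
  set Lop : (ℝ → UnitAddTorus d → EuclideanSpace ℝ d) → ℝ × UnitAddTorus d → EuclideanSpace ℝ d := fun ψ p =>
    FunctionSpaces.Torus.timeDeriv ψ p.1 p.2 - ψ p.1 p.2 + FunctionSpaces.Torus.convect (b p.1) (ψ p.1) p.2 +
      viscAdjVar (𝔹 p.1) (ψ p.1) p.2 with hLop
  have memK : ∀ ψ : S, MemLp (Lop (ψ : ℝ → UnitAddTorus d → EuclideanSpace ℝ d)) 2 μ := fun ψ =>
    memLp_two_dampedOpVar h𝔹s h𝔹c h𝔹d (hS ψ).1 hbm hbM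
  let K₀ : S → Lp (EuclideanSpace ℝ d) 2 μ := fun ψ => (memK ψ).toLp _
  have hK₀add : ∀ ψ χ : S, K₀ (ψ + χ) = K₀ ψ + K₀ χ := by
    intro ψ χ
    rw [← MemLp.toLp_add]
    refine (MemLp.toLp_eq_toLp_iff _ _).2 (ae_of_all _ fun p => ?_)
    exact dampedOpVar_add h𝔹s (hS ψ).1 (hS χ).1 p
  have hK₀smul : ∀ (c : ℝ) (ψ : S), K₀ (c • ψ) = c • K₀ ψ := by
    intro c ψ
    rw [← MemLp.toLp_const_smul]
    refine (MemLp.toLp_eq_toLp_iff _ _).2 (ae_of_all _ fun p => ?_)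
    exact dampedOpVar_const_smul 𝔹 (hS ψ).1 c p
  -- ### the bilinear form `E(u, ψ) = -⟪K₀ ψ, u⟫`
  let E : Fsub →ₗ[ℝ] S →ₗ[ℝ] ℝ := LinearMap.mk₂ ℝ
    (fun u ψ => -⟪K₀ ψ, (u : Lp (EuclideanSpace ℝ d) 2 μ)⟫_ℝ)
    (fun u u' ψ => by simp only [Submodule.coe_add, inner_add_right, neg_add])
    (fun c u ψ => by simp only [Submodule.coe_smul, inner_smul_right, smul_eq_mul, mul_neg])
    (fun u ψ χ => by rw [hK₀add, inner_add_left, neg_add])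
    (fun c u ψ => by rw [hK₀smul, real_inner_smul_left, smul_eq_mul, mul_neg])
  have hE : ∀ ψ : S, ∃ Kc : ℝ, ∀ u : Fsub, |E u ψ| ≤ Kc * ‖u‖ := by
    intro ψ
    refine ⟨‖K₀ ψ‖, fun u => ?_⟩
    show |-⟪K₀ ψ, (u : Lp (EuclideanSpace ℝ d) 2 μ)⟫_ℝ| ≤ ‖K₀ ψ‖ * ‖u‖
    rw [abs_neg]
    exact (abs_real_inner_le_norm _ _).trans (le_of_eq (by rw [Submodule.coe_norm]))
  -- ### the size function and the datum functional
  let q : S → ℝ := fun ψ => Real.sqrt (‖j₀ ψ‖ ^ 2 + (1 / 2) * ∫ x, ‖(ψ : ℝ → UnitAddTorus d → EuclideanSpace ℝ d) 0 x‖ ^ 2)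
  have hq : ∀ ψ, 0 ≤ q ψ := fun ψ => Real.sqrt_nonneg _
  have hj : ∀ ψ, ‖j ψ‖ ≤ 1 * q ψ := by
    intro ψ
    rw [one_mul]
    show ‖(⟨j₀ ψ, hj₀mem ψ⟩ : Fsub)‖ ≤ q ψ
    rw [Submodule.coe_norm]
    refine Real.le_sqrt_of_sq_le ?_
    have h0 : 0 ≤ (1 / 2) * ∫ x, ‖(ψ : ℝ → UnitAddTorus d → EuclideanSpace ℝ d) 0 x‖ ^ 2 :=
      mul_nonneg (by norm_num) (integral_nonneg fun x => sq_nonneg _)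
    linarith
  -- ### coercivity (`PassiveVectorTestForms.setIntegral_passiveForm_ge`)
  have hcoer : ∀ ψ : S, 1 * q ψ ^ 2 ≤ E (j ψ) ψ := by
    intro ψ
    obtain ⟨hψ, hdiv⟩ := hS ψ
    rw [one_mul, Real.sq_sqrt (by
      have h0 : 0 ≤ (1 / 2) * ∫ x, ‖(ψ : ℝ → UnitAddTorus d → EuclideanSpace ℝ d) 0 x‖ ^ 2 :=
        mul_nonneg (by norm_num) (integral_nonneg fun x => sq_nonneg _)
      positivity)]
    show ‖j₀ ψ‖ ^ 2 + (1 / 2) * ∫ x, ‖(ψ : ℝ → UnitAddTorus d → EuclideanSpace ℝ d) 0 x‖ ^ 2 ≤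
      -⟪K₀ ψ, j₀ ψ⟫_ℝ
    -- the `L²(μ)` inner product as a space–time integral
    have hinner : ⟪K₀ ψ, j₀ ψ⟫_ℝ = ∫ p, ⟪(ψ : ℝ → UnitAddTorus d → EuclideanSpace ℝ d) p.1 p.2,
        Lop (ψ : ℝ → UnitAddTorus d → EuclideanSpace ℝ d) p⟫_ℝ ∂μ := by
      rw [MeasureTheory.L2.inner_def]
      refine integral_congr_ae ?_
      filter_upwards [(memK ψ).coeFn_toLp, (memj ψ).coeFn_toLp] with p hp hq'
      rw [show (K₀ ψ : ℝ × UnitAddTorus d → EuclideanSpace ℝ d) p = Lop _ p from hp,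
        show (j₀ ψ : ℝ × UnitAddTorus d → EuclideanSpace ℝ d) p = uncurry _ p from hq', real_inner_comm]
      rfl
    have hnorm : ‖j₀ ψ‖ ^ 2 = ∫ t in Ioo 0 T, ∫ x, ‖(ψ : ℝ → UnitAddTorus d → EuclideanSpace ℝ d) t x‖ ^ 2 := by
      have h1 : ‖j₀ ψ‖ ^ 2 = ∫ p, ‖uncurry (ψ : ℝ → UnitAddTorus d → EuclideanSpace ℝ d) p‖ ^ 2 ∂μ := by
        rw [← real_inner_self_eq_norm_sq, MeasureTheory.L2.inner_def]
        refine integral_congr_ae ?_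
        filter_upwards [(memj ψ).coeFn_toLp] with p hp
        rw [show (j₀ ψ : ℝ × UnitAddTorus d → EuclideanSpace ℝ d) p = uncurry _ p from hp, real_inner_self_eq_norm_sq]
      rw [h1, hμ, integral_prod _ ((memj ψ).integrable_norm_pow two_ne_zero)]
      rfl
    have hprod : ∫ p, ⟪(ψ : ℝ → UnitAddTorus d → EuclideanSpace ℝ d) p.1 p.2,
        Lop (ψ : ℝ → UnitAddTorus d → EuclideanSpace ℝ d) p⟫_ℝ ∂μ =
        ∫ t in Ioo 0 T, ∫ x, ⟪(ψ : ℝ → UnitAddTorus d → EuclideanSpace ℝ d) t x,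
          FunctionSpaces.Torus.timeDeriv (ψ : ℝ → UnitAddTorus d → EuclideanSpace ℝ d) t x -
            (ψ : ℝ → UnitAddTorus d → EuclideanSpace ℝ d) t x +
            FunctionSpaces.Torus.convect (b t) ((ψ : ℝ → UnitAddTorus d → EuclideanSpace ℝ d) t) x +
            viscAdjVar (𝔹 t) ((ψ : ℝ → UnitAddTorus d → EuclideanSpace ℝ d) t) x⟫_ℝ := by
      have hint : Integrable (fun p : ℝ × UnitAddTorus d => ⟪(ψ : ℝ → UnitAddTorus d → EuclideanSpace ℝ d) p.1 p.2,
          Lop (ψ : ℝ → UnitAddTorus d → EuclideanSpace ℝ d) p⟫_ℝ) μ := by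
        refine Integrable.mono' ((((memj ψ).integrable_norm_pow two_ne_zero).add
          ((memK ψ).integrable_norm_pow two_ne_zero)).div_const 2) ((memj ψ).1.inner (memK ψ).1)
          (ae_of_all _ fun p => ?_)
        rw [Real.norm_eq_abs]
        have h := abs_real_inner_le_norm ((ψ : ℝ → UnitAddTorus d → EuclideanSpace ℝ d) p.1 p.2)
          (Lop (ψ : ℝ → UnitAddTorus d → EuclideanSpace ℝ d) p)
        have h2 : ‖(ψ : ℝ → UnitAddTorus d → EuclideanSpace ℝ d) p.1 p.2‖ *
            ‖Lop (ψ : ℝ → UnitAddTorus d → EuclideanSpace ℝ d) p‖ ≤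
            (‖uncurry (ψ : ℝ → UnitAddTorus d → EuclideanSpace ℝ d) p‖ ^ 2 +
              ‖Lop (ψ : ℝ → UnitAddTorus d → EuclideanSpace ℝ d) p‖ ^ 2) / 2 := by
          have : ‖uncurry (ψ : ℝ → UnitAddTorus d → EuclideanSpace ℝ d) p‖ =
              ‖(ψ : ℝ → UnitAddTorus d → EuclideanSpace ℝ d) p.1 p.2‖ := rfl
          rw [this]
          nlinarith [sq_nonneg (‖(ψ : ℝ → UnitAddTorus d → EuclideanSpace ℝ d) p.1 p.2‖ -
            ‖Lop (ψ : ℝ → UnitAddTorus d → EuclideanSpace ℝ d) p‖)]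
        exact h.trans h2
      rw [hμ, integral_prod _ hint]
    rw [hinner, hnorm, hprod]
    exact setIntegral_varTensorForm_ge hT h𝔸 h𝔹s h𝔹c h𝔹d hδ hlo hψ hdiv hbdiv hbm hbM
  -- ### the datum functional
  have hintL : ∀ ψ : S, Integrable (fun x => ⟪w₀ x, (ψ : ℝ → UnitAddTorus d → EuclideanSpace ℝ d) 0 x⟫_ℝ) volume :=
    fun ψ => FunctionSpaces.Torus.integrable_inner_of_continuous (hw₀.integrable one_le_two)
      ((hS ψ).1.isSmooth_slice 0).continuous
  let L : S →ₗ[ℝ] ℝ :=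
    { toFun := fun ψ => ∫ x, ⟪w₀ x, (ψ : ℝ → UnitAddTorus d → EuclideanSpace ℝ d) 0 x⟫_ℝ
      map_add' := fun ψ χ => by
        show ∫ x, ⟪w₀ x, ((ψ : ℝ → UnitAddTorus d → EuclideanSpace ℝ d) + χ) 0 x⟫_ℝ = _
        simp only [Pi.add_apply, inner_add_right]
        exact integral_add (hintL ψ) (hintL χ)
      map_smul' := fun c ψ => by
        show ∫ x, ⟪w₀ x, (c • (ψ : ℝ → UnitAddTorus d → EuclideanSpace ℝ d)) 0 x⟫_ℝ = _
        simp only [Pi.smul_apply, real_inner_smul_right, integral_const_mul, smul_eq_mul, RingHom.id_apply] }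
  have hL : ∀ ψ : S, |L ψ| ≤ Real.sqrt 2 * Real.sqrt (∫ x, ‖w₀ x‖ ^ 2) * q ψ := by
    intro ψ
    show |∫ x, ⟪w₀ x, (ψ : ℝ → UnitAddTorus d → EuclideanSpace ℝ d) 0 x⟫_ℝ| ≤ _
    have hψ0 : MemLp ((ψ : ℝ → UnitAddTorus d → EuclideanSpace ℝ d) 0) 2 volume :=
      ((hS ψ).1.isSmooth_slice 0).continuous.memLp_of_hasCompactSupport (HasCompactSupport.of_compactSpace _)
    have hcs : |∫ x, ⟪w₀ x, (ψ : ℝ → UnitAddTorus d → EuclideanSpace ℝ d) 0 x⟫_ℝ| ≤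
        Real.sqrt (∫ x, ‖w₀ x‖ ^ 2) * Real.sqrt (∫ x, ‖(ψ : ℝ → UnitAddTorus d → EuclideanSpace ℝ d) 0 x‖ ^ 2) := by
      calc |∫ x, ⟪w₀ x, (ψ : ℝ → UnitAddTorus d → EuclideanSpace ℝ d) 0 x⟫_ℝ|
          ≤ ∫ x, |⟪w₀ x, (ψ : ℝ → UnitAddTorus d → EuclideanSpace ℝ d) 0 x⟫_ℝ| := abs_integral_le_integral_abs
        _ ≤ ∫ x, ‖w₀ x‖ * ‖(ψ : ℝ → UnitAddTorus d → EuclideanSpace ℝ d) 0 x‖ :=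
            integral_mono_of_nonneg (ae_of_all _ fun x => abs_nonneg _)
              (by
                obtain ⟨C, hC⟩ := (isCompact_univ.image ((hS ψ).1.isSmooth_slice 0).continuous).isBounded.exists_norm_le
                have hC' : ∀ x, ‖(ψ : ℝ → UnitAddTorus d → EuclideanSpace ℝ d) 0 x‖ ≤ C := fun x => hC _ ⟨x, mem_univ _, rfl⟩
                exact ((hw₀.integrable one_le_two).norm.mul_const C).mono'
                  ((hw₀.integrable one_le_two).norm.aestronglyMeasurable.mul hψ0.1.norm)
                  (ae_of_all _ fun x => by
                    rw [Real.norm_eq_abs, abs_of_nonneg (mul_nonneg (norm_nonneg _) (norm_nonneg _))]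
                    exact mul_le_mul_of_nonneg_left (hC' x) (norm_nonneg _)))
              (ae_of_all _ fun x => abs_real_inner_le_norm _ _)
        _ ≤ _ := FunctionSpaces.Torus.integral_norm_mul_norm_le_sqrt_sq_mul_sqrt_sq hw₀ hψ0
    have hq2 : Real.sqrt (∫ x, ‖(ψ : ℝ → UnitAddTorus d → EuclideanSpace ℝ d) 0 x‖ ^ 2) ≤ Real.sqrt 2 * q ψ := by
      rw [← Real.sqrt_mul (by norm_num : (0:ℝ) ≤ 2)]
      refine Real.sqrt_le_sqrt ?_
      have hn : 0 ≤ ‖j₀ ψ‖ ^ 2 := sq_nonneg _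
      show ∫ x, ‖(ψ : ℝ → UnitAddTorus d → EuclideanSpace ℝ d) 0 x‖ ^ 2 ≤
        2 * (‖j₀ ψ‖ ^ 2 + (1 / 2) * ∫ x, ‖(ψ : ℝ → UnitAddTorus d → EuclideanSpace ℝ d) 0 x‖ ^ 2)
      linarith
    calc |∫ x, ⟪w₀ x, (ψ : ℝ → UnitAddTorus d → EuclideanSpace ℝ d) 0 x⟫_ℝ|
        ≤ Real.sqrt (∫ x, ‖w₀ x‖ ^ 2) * (Real.sqrt 2 * q ψ) :=
          hcs.trans (mul_le_mul_of_nonneg_left hq2 (Real.sqrt_nonneg _))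
      _ = Real.sqrt 2 * Real.sqrt (∫ x, ‖w₀ x‖ ^ 2) * q ψ := by ring
  -- ### Lions' theorem
  obtain ⟨u, hu⟩ := Literature.Analysis.OperatorTheory.exists_eq_of_coercive j q hq zero_le_one hj E hE one_pos hcoer L
    (by positivity) hL
  refine ⟨(u : Lp (EuclideanSpace ℝ d) 2 μ), ?_, fun ψ hψ hdiv => ?_⟩
  · -- membership: `Fsub` is contained in the closure of the span of the advertised set
    have hsub : Set.range j₀ ⊆ {f : Lp (EuclideanSpace ℝ d) 2 μ |
        ∃ ψ : ℝ → UnitAddTorus d → EuclideanSpace ℝ d, FunctionSpaces.Torus.IsSpaceTimeTest T ψ ∧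
          FunctionSpaces.Torus.IsDivFreeTest ψ ∧ (f : ℝ × UnitAddTorus d → EuclideanSpace ℝ d) =ᵐ[μ] uncurry ψ} := by
      rintro f ⟨ψ, rfl⟩
      exact ⟨ψ, (hS ψ).1, (hS ψ).2, (memj ψ).coeFn_toLp⟩
    exact Submodule.topologicalClosure_mono (Submodule.span_mono hsub) u.2
  · have h := hu ⟨ψ, hψ, hdiv⟩
    -- `E u ψ = -⟪K₀ ψ, u⟫ = L ψ = ∫⟪w₀, ψ 0⟫`
    change -⟪K₀ ⟨ψ, hψ, hdiv⟩, (u : Lp (EuclideanSpace ℝ d) 2 μ)⟫_ℝ = ∫ x, ⟪w₀ x, ψ 0 x⟫_ℝ at h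
    have hinner : ⟪K₀ ⟨ψ, hψ, hdiv⟩, (u : Lp (EuclideanSpace ℝ d) 2 μ)⟫_ℝ =
        ∫ p, ⟪(u : ℝ × UnitAddTorus d → EuclideanSpace ℝ d) p, Lop ψ p⟫_ℝ ∂μ := by
      rw [MeasureTheory.L2.inner_def]
      refine integral_congr_ae ?_
      filter_upwards [(memK ⟨ψ, hψ, hdiv⟩).coeFn_toLp] with p hp
      rw [show (K₀ ⟨ψ, hψ, hdiv⟩ : ℝ × UnitAddTorus d → EuclideanSpace ℝ d) p = Lop ψ p from hp, real_inner_comm]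
    rw [hinner] at h
    linarith


end Torus

end Literature.Analysis.FluidPDE

end
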